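import Summits.MatrixMultiplication.MatrixMultiplication.Theorems.SaturationLadderTransferLaw
import HarnessLib

/-!
# Route `SaturationLadder` — transfer law, chain file 2: rigidity of the onset ladder; the length floor
(decomp-mm lens 1 «grading / quantitative ladder», gen 27; route-free helper: imports NO `Theses` file)

Continues `Theorems/SaturationLadderTransferLaw.lean` (the laws of an exact single-base certificate between matrix
multiplication formats: `b·a' ≤ a·b'`, `b·c' ≤ c·b'`, …).
* §3 RIGIDITY: an exact certificate for an inner-square target `⟨q^a,q^b,q^b⟩` forces an inner-square base `c' = b'` with
  `b·a' ≤ a·b'`, tight (`exact_innerSquareTarget`) — a format that ALREADY proves the far rung `E_j` (`j ≥ a/b`) by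
  padding (`far_of_innerSquare_tight`, `K` arbitrary), so exact far-format certificates are REDUNDANT
  (`exact_farTarget_redundant`); cube targets need tight cube bases (`exact_cubeTarget_base_cube`: an in-class certificate
  of `ω = 2` presupposes a flat cube); every certificate from a far base `⟨p^k,p,p⟩` for an inner-square target obeys
  `U ≥ b·ω(k,1,1) ≥ b(k+1)` (`farBase_innerSquareTarget_floor`, the `ζ⁽³⁾`-floor).  The ONSET NUMBER never decreases
  under single-base exact transfer: `TailDescentTwo` (stmt-29474: grade `≥ 3` to grade `2`), `SquareFromTwo` (stmt-29475:
  grade `2` to the cube) and every onset rung of gen 17's ladder lie OUTSIDE this method class.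
* §4 the LENGTH FLOOR `log 4 · b/(a−b) ≤ log((a+c)/b) + 1 − log 2` (satisfied by the X-perfect catalogue, chain file 3)
  propagates from base to target along the laws (`lengthFloor_transfer`).
Support module beneath stmt-MatrixMultiplication-25909; closes no item; 0 sorry; no definitions; BUILT imports only.
[cite: ChristandlLeGallLysikovZuiddam2020, Thm. 3.10 and Lemma 4.1; LottiRomani1983, §1 (p. 173); HuangPan1998, §2
eq. (2.4) and (2.8); Strassen1988, §3; AlmanDuanVassilevskaWilliamsXuXuZhou2025, §3.4]
-/

set_option linter.dupNamespace false

noncomputable section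

open scoped BigOperators

namespace Summit.MatrixMultiplication.MatrixMultiplication.Theorems.SaturationLadderTransferLawRigidity

open Literature.Computability.AlgebraicComplexity
open Literature.Barriers.MatrixMultiplication
open Summit.MatrixMultiplication.MatrixMultiplication.Theorems.SaturationLadderSpectralFloor
  (gauge₃_floor)  -- landed, imported
open Summit.MatrixMultiplication.MatrixMultiplication.Theorems.SaturationLadderFlatFormats
  (log_asymptoticRank_matMulTensor_rect tight_add)  -- landed, imported
open Summit.MatrixMultiplication.MatrixMultiplication.Theorems.SaturationLadderTransferLaw
  (exact_skeleton exact_base_tight exact_target_inner_le exact_thinness_law exact_length_law)  -- chain file 1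

variable {K : Type} [Field K]

/-! ## 3. Rigidity of the onset ladder under single-base exact transfer -/

section Rigidity

/-- **Padding along the far edge** (`K` arbitrary): a tight inner-square format `ω(a',b',b') = a'+b'` with
`a' ≤ j·b'`, `b' ≥ 1` gives `E_j`: `ω(j,1,1) = j+1` (Kronecker product with the outer product `⟨p^{jb'−a'},1,1⟩`,
`ω(x,0,0) = x`; then homogeneity by `b'`). [cite: LottiRomani1983, §1 (p. 173); HuangPan1998, §2 eq. (2.4) and (2.8)] -/
theorem far_of_innerSquare_tight {a' b' j : ℕ} (hb' : 1 ≤ b') (hj : a' ≤ j * b')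
    (hT : omegaRect K a' b' b' = ((a' + b' : ℕ) : ℝ)) :
    omegaRect K j 1 1 = (j : ℝ) + 1 := by
  have hpad : omegaRect K ((j * b' - a' : ℕ) : ℝ) ((0 : ℕ) : ℝ) ((0 : ℕ) : ℝ) =
      ((j * b' - a' + 0 : ℕ) : ℝ) := by
    rw [omegaRect_eq_add_of_nonpos₃ K (Nat.cast_nonneg _) (Nat.cast_nonneg _) (by simp)]
    push_cast; ring
  have hsum := tight_add (K := K) hT hpad
  have e1 : a' + (j * b' - a') = j * b' := by omega
  have e2 : b' + 0 = b' := by omega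
  rw [e1, e2] at hsum
  have hb'0 : (0 : ℝ) ≤ b' := Nat.cast_nonneg _
  have hhom := LottiRomani1983_homogeneous K hb'0 (Nat.cast_nonneg j) zero_le_one zero_le_one
  rw [mul_one] at hhom
  have e3 : ((j * b' : ℕ) : ℝ) = (b' : ℝ) * j := by push_cast; ring
  rw [e3, hhom] at hsum
  have hb'pos : (0 : ℝ) < b' := by exact_mod_cast hb'
  have : (b' : ℝ) * omegaRect K j 1 1 = (b' : ℝ) * ((j : ℝ) + 1) := by
    rw [hsum]; push_cast; ring
  exact mul_left_cancel₀ hb'pos.ne' this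

variable {p a' b' c' N t q : ℕ}

/-- **Inner-square targets have inner-square bases.**  An exact certificate for `⟨q^a,q^b,q^b⟩` (`b ≥ 1`) from a
power of `⟨p^{a'},p^{b'},p^{c'}⟩` forces `c' = b'`, `b·a' ≤ a·b'` and `ω(a',b',b') = a'+b'`: the base sits at a
far-tight rational length `a'/b' ≤ a/b`. [cite: ChristandlLeGallLysikovZuiddam2020, Thm. 3.10 and Lemma 4.1] -/
theorem exact_innerSquareTarget {a b : ℕ} (hp : 2 ≤ p) (hq : 2 ≤ q) (ht : 1 ≤ t) (hb : 1 ≤ b)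
    (h : PolyDegeneratesTo (kroneckerPow (matMulTensor K (p ^ a') (p ^ b') (p ^ c')) N)
      (kroneckerTensor (unitTensor K t) (matMulTensor K (q ^ a) (q ^ b) (q ^ b))))
    (hU : ((N : ℝ) * (omegaRect K a' b' c' * Real.log p) - Real.log t) / Real.log q ≤ ((a + b : ℕ) : ℝ)) :
    c' = b' ∧ b * a' ≤ a * b' ∧ omegaRect K a' b' b' = ((a' + b' : ℕ) : ℝ) := by
  have hac : 1 ≤ a + b := by omega
  obtain ⟨hT, -, hbc'⟩ := exact_base_tight hp hq ht h hac hU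
  have hlen := exact_length_law hp hq ht h hac hU
  have hthin := exact_thinness_law hp hq ht h hac hU
  have hcb : c' ≤ b' := by
    by_contra hlt
    have : b * (b' + 1) ≤ b * c' := Nat.mul_le_mul_left b (by omega)
    nlinarith
  have hc : c' = b' := le_antisymm hcb hbc'
  subst hc
  exact ⟨rfl, hthin, hT⟩

/-- **Exact far-format certificates are REDUNDANT**: whatever matrix multiplication base exactly certifies the far
format `⟨q^{jb},q^b,q^b⟩` of grade `j` (`b ≥ 1`) already proves `E_j`, `ω(j,1,1) = j+1`, by padding alone — the
engine moves along the far edge only UPWARD in the grade. [cite: LottiRomani1983, §1 (p. 173); ChristandlLeGallLysikovZuiddam2020, Thm. 3.10] -/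
theorem exact_farTarget_redundant {j b : ℕ} (hp : 2 ≤ p) (hq : 2 ≤ q) (ht : 1 ≤ t) (hb : 1 ≤ b)
    (h : PolyDegeneratesTo (kroneckerPow (matMulTensor K (p ^ a') (p ^ b') (p ^ c')) N)
      (kroneckerTensor (unitTensor K t) (matMulTensor K (q ^ (j * b)) (q ^ b) (q ^ b))))
    (hU : ((N : ℝ) * (omegaRect K a' b' c' * Real.log p) - Real.log t) / Real.log q ≤
      ((j * b + b : ℕ) : ℝ)) :
    omegaRect K j 1 1 = (j : ℝ) + 1 := by
  obtain ⟨-, hthin, hT⟩ := exact_innerSquareTarget hp hq ht hb h hU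
  obtain ⟨-, hY, hL, -, -, -, p2, -⟩ := exact_skeleton hp hq ht h (by omega : 1 ≤ j * b + b) hU
  -- `b' ≥ 1`: otherwise `a' = 0` too (thinness law) and the `ζ⁽²⁾`-packing `(a+b)L ≤ (a'+b')Y = 0` fails
  have hb'1 : 1 ≤ b' := by
    by_contra hb'0
    have hb'0 : b' = 0 := by omega
    subst hb'0
    have ha' : a' = 0 := by
      rcases Nat.eq_zero_or_pos a' with h0 | h0
      · exact h0
      · exfalso
        have : 1 * 1 ≤ b * a' := Nat.mul_le_mul hb h0
        rw [Nat.mul_zero] at hthin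
        omega
    subst ha'
    have hbR : (1 : ℝ) ≤ b := by exact_mod_cast hb
    push_cast at p2
    have : (1 : ℝ) * Real.log q ≤ ((j : ℝ) * b + b) * Real.log q :=
      mul_le_mul_of_nonneg_right (by nlinarith) hL.le
    nlinarith
  refine far_of_innerSquare_tight (K := K) hb'1 ?_ hT
  have : b * a' ≤ b * (j * b') := by rw [← Nat.mul_assoc]; simpa [Nat.mul_comm] using hthin
  exact Nat.le_of_mul_le_mul_left this (by omega)

/-- **Cube targets have cube bases**: an exact certificate for `⟨q^b,q^b,q^b⟩` (`b ≥ 1`) forces `a' = b' = c'` and a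
tight base cube, i.e. `ω(b',b',b') = 2b'` — in-class certificates of the summit `ω = 2` presuppose it.
[cite: ChristandlLeGallLysikovZuiddam2020, Thm. 3.10 and Lemma 4.1; Strassen1988, §3] -/
theorem exact_cubeTarget_base_cube {b : ℕ} (hp : 2 ≤ p) (hq : 2 ≤ q) (ht : 1 ≤ t) (hb : 1 ≤ b)
    (h : PolyDegeneratesTo (kroneckerPow (matMulTensor K (p ^ a') (p ^ b') (p ^ c')) N)
      (kroneckerTensor (unitTensor K t) (matMulTensor K (q ^ b) (q ^ b) (q ^ b))))
    (hU : ((N : ℝ) * (omegaRect K a' b' c' * Real.log p) - Real.log t) / Real.log q ≤ ((b + b : ℕ) : ℝ)) :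
    a' = b' ∧ c' = b' ∧ omegaRect K b' b' b' = ((b' + b' : ℕ) : ℝ) := by
  obtain ⟨hc, hthin, hT⟩ := exact_innerSquareTarget hp hq ht hb h hU
  obtain ⟨-, hba', -⟩ := exact_base_tight hp hq ht h (by omega : 1 ≤ b + b) hU
  have hab : a' ≤ b' := by
    by_contra hlt
    have : b * (b' + 1) ≤ b * a' := Nat.mul_le_mul_left b (by omega)
    nlinarith
  have ha : a' = b' := le_antisymm hab hba'
  subst ha
  exact ⟨rfl, hc, hT⟩

/-- **The class invariant `J₃`: `b < c`, or `c = b ∧ 3b ≤ a` — preserved by exact single-base transfer.**  It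
holds for the far formats `(k,1,1)`, `k ≥ 3`, their mirrors `(1,1,k)`, the X-perfect catalogue and the near-square
family (all have `b < c`; chain file 3), is closed under Kronecker sums (`classInvariant_add`), and FAILS for the
level-two format `(2,1,1)` and the cube (`classInvariant_basics`).  So the closure of the tree's flat catalogue under
sums and exact transfers never contains `⟨p²,p,p⟩` or `⟨p,p,p⟩`: in-class, `TailDescentTwo`, `SquareFromTwo` and the
summit are unreachable. [cite: ChristandlLeGallLysikovZuiddam2020, Thm. 3.10 and Lemma 4.1; LottiRomani1983, §1 (p. 173)] -/
theorem exact_classInvariant {a b c : ℕ} (hp : 2 ≤ p) (hq : 2 ≤ q) (ht : 1 ≤ t)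
    (h : PolyDegeneratesTo (kroneckerPow (matMulTensor K (p ^ a') (p ^ b') (p ^ c')) N)
      (kroneckerTensor (unitTensor K t) (matMulTensor K (q ^ a) (q ^ b) (q ^ c))))
    (hac : 1 ≤ a + c)
    (hU : ((N : ℝ) * (omegaRect K a' b' c' * Real.log p) - Real.log t) / Real.log q ≤ ((a + c : ℕ) : ℝ))
    (hJ : b' < c' ∨ (c' = b' ∧ 3 * b' ≤ a')) : b < c ∨ (c = b ∧ 3 * b ≤ a) := by
  obtain ⟨-, hbc⟩ := exact_target_inner_le hp hq ht h hac hU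
  have hthin := exact_thinness_law hp hq ht h hac hU
  have hlen := exact_length_law hp hq ht h hac hU
  obtain ⟨-, hY, hL, -, -, -, -, p3⟩ := exact_skeleton hp hq ht h hac hU
  rcases Nat.eq_zero_or_pos b with hb0 | hb0
  · subst hb0
    rcases Nat.eq_zero_or_pos c with hc0 | hc0
    · exact Or.inr ⟨hc0, by omega⟩
    · exact Or.inl hc0
  rcases hbc.lt_or_eq with hlt | heq
  · exact Or.inl hlt
  refine Or.inr ⟨heq.symm, ?_⟩
  rcases hJ with hJ | ⟨hc', h3⟩
  · -- length law with `c = b`: `b·c' ≤ b·b'`, contradicting `b' < c'`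
    rw [← heq] at hlen
    have := Nat.le_of_mul_le_mul_left hlen hb0
    omega
  · rcases Nat.eq_zero_or_pos b' with hb'0 | hb'0
    · -- base `⟨p^{a'},1,1⟩`: the `ζ⁽³⁾`-packing `(b+c)·log q ≤ 0` is absurd
      exfalso
      have e1 : (b' : ℝ) = 0 := by exact_mod_cast hb'0
      have e2 : (c' : ℝ) = 0 := by exact_mod_cast (hc'.trans hb'0)
      rw [e1, e2] at p3
      have hbR : (1 : ℝ) ≤ b := by exact_mod_cast hb0
      have hcR : (0 : ℝ) ≤ c := Nat.cast_nonneg c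
      nlinarith
    · have h1 : 3 * b * b' ≤ a * b' :=
        calc 3 * b * b' = b * (3 * b') := by ring
          _ ≤ b * a' := Nat.mul_le_mul_left b h3
          _ ≤ a * b' := hthin
      exact Nat.le_of_mul_le_mul_right h1 hb'0

/-- `J₃` is closed under Kronecker sums of formats (exponent triples add; `tight_add`). [folklore] -/
theorem classInvariant_add {a b c a₂ b₂ c₂ : ℕ} (h₁ : b < c ∨ (c = b ∧ 3 * b ≤ a))
    (h₂ : b₂ < c₂ ∨ (c₂ = b₂ ∧ 3 * b₂ ≤ a₂)) :
    b + b₂ < c + c₂ ∨ (c + c₂ = b + b₂ ∧ 3 * (b + b₂) ≤ a + a₂) := by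
  omega

/-- `J₃` holds for `(k,1,1)` (`k ≥ 3`) and `(1,1,k)`, and fails for `(2,1,1)` and `(1,1,1)`. [folklore] -/
theorem classInvariant_basics (k : ℕ) (hk : 3 ≤ k) :
    (1 < 1 ∨ (1 = 1 ∧ 3 * 1 ≤ k)) ∧ (1 < k ∨ (k = 1 ∧ 3 * 1 ≤ 1)) ∧
    ¬ (1 < 1 ∨ (1 = 1 ∧ 3 * 1 ≤ 2)) ∧ ¬ (1 < 1 ∨ (1 = 1 ∧ 3 * 1 ≤ 1)) := by
  omega

/-- **Far base, far target: the floor `U ≥ ω(k,1,1) ≥ k+1`.**  Every certificate (exact or not) from a power of the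
far format `⟨p^k,p,p⟩` for an inner-square target `⟨q^a,q^b,q^b⟩` with `b ≥ 1` has certified exponent
`U ≥ b·ω(k,1,1) ≥ b(k+1)` (the `ζ⁽³⁾`-floor, `ζ⁽³⁾(⟨p^k,p,p⟩) = p²`): a grade-`k` far base certifies along the far
edge nothing below its own grade — for the level-two format `⟨q²,q,q⟩` and `k ≥ 3` the defect is at least `k − 2 ≥ 1`.
[cite: ChristandlLeGallLysikovZuiddam2020, Thm. 3.10 and Lemma 4.1] -/
theorem farBase_innerSquareTarget_floor (k : ℕ) {a b : ℕ} (hp : 2 ≤ p) (hq : 2 ≤ q) (ht : 1 ≤ t)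
    (h : PolyDegeneratesTo (kroneckerPow (matMulTensor K (p ^ k) (p ^ 1) (p ^ 1)) N)
      (kroneckerTensor (unitTensor K t) (matMulTensor K (q ^ a) (q ^ b) (q ^ b)))) :
    (b : ℝ) * ((k : ℝ) + 1) ≤ (b : ℝ) * omegaRect K k 1 1 ∧
    (b : ℝ) * omegaRect K k 1 1 ≤
      ((N : ℝ) * (omegaRect K k 1 1 * Real.log p) - Real.log t) / Real.log q := by
  have hp1 : (1 : ℝ) < p := by exact_mod_cast (by omega : 1 < p)
  have hp0 : (0 : ℝ) < p := by linarith
  have hlogp : 0 < Real.log p := Real.log_pos hp1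
  have hζ : gaugePoint₃ K (matMulTensor K (p ^ k) (p ^ 1) (p ^ 1)) = (p : ℝ) ^ 2 := by
    rw [gaugePoint₃_matMulTensor (K := K) (pow_pos (by omega) k)]; push_cast; ring
  have hT : 1 < gaugePoint₃ K (matMulTensor K (p ^ k) (p ^ 1) (p ^ 1)) := by
    rw [hζ]; nlinarith
  have hω := add_le_omegaRect₁₃ K (k : ℝ) 1 1
  have hω2 := add_le_omegaRect₂₃ K (k : ℝ) 1 1
  have hR : Real.log (asymptoticRank (matMulTensor K (p ^ k) (p ^ 1) (p ^ 1))) =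
      omegaRect K k 1 1 * Real.log p := by
    rw [log_asymptoticRank_matMulTensor_rect hp]; push_cast; ring
  have hr : gaugePoint₃ K (matMulTensor K (p ^ k) (p ^ 1) (p ^ 1)) ≤
      asymptoticRank (matMulTensor K (p ^ k) (p ^ 1) (p ^ 1)) := by
    rw [hζ, asymptoticRank_matMulTensor_rect K hp k 1 1]
    have : (p : ℝ) ^ (2 : ℕ) = (p : ℝ) ^ ((2 : ℕ) : ℝ) := (Real.rpow_natCast _ 2).symm
    rw [this]
    exact Real.rpow_le_rpow_of_exponent_le hp1.le (by push_cast; linarith)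
  have hfl := gauge₃_floor _ hq ht h hT hr
  have hZ : Real.log (gaugePoint₃ K (matMulTensor K (p ^ k) (p ^ 1) (p ^ 1))) = 2 * Real.log p := by
    rw [hζ, Real.log_pow]; push_cast; ring
  rw [hR, hZ] at hfl
  have e : ((b + b : ℕ) : ℝ) * (omegaRect K (k : ℝ) 1 1 * Real.log p / (2 * Real.log p)) =
      (b : ℝ) * omegaRect K k 1 1 := by
    field_simp; push_cast; ring
  rw [e] at hfl
  exact ⟨mul_le_mul_of_nonneg_left (by linarith) (Nat.cast_nonneg b), hfl⟩

end Rigidity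

/-! ## 4. The length floor propagates along exact transfers -/

section LengthFloor

/-- **Propagation of the length floor.**  If the base format obeys `b' < a'` and the length floor
`log 4 · b'/(a'−b') ≤ log((a'+c')/b') + 1 − log 2`, and the laws `b·a' ≤ a·b'`, `b·c' ≤ c·b'` hold (exact transfer,
§2), then the target obeys `b < a` and the same floor `log 4 · b/(a−b) ≤ log((a+c)/b) + 1 − log 2`: the invariant
`κ = b/(a−b)` can only fall and the normalised outer length `(a+c)/b` only grow. [folklore] -/
theorem lengthFloor_transfer {a b c a' b' c' : ℕ} (hb : 1 ≤ b) (hb' : 1 ≤ b') (hab' : b' < a')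
    (hthin : b * a' ≤ a * b') (hlen : b * c' ≤ c * b')
    (hfloor : Real.log 4 * ((b' : ℝ) / ((a' : ℝ) - b')) ≤
      Real.log (((a' : ℝ) + c') / b') + 1 - Real.log 2) :
    b < a ∧ Real.log 4 * ((b : ℝ) / ((a : ℝ) - b)) ≤ Real.log (((a : ℝ) + c) / b) + 1 - Real.log 2 := by
  have hbR : (1 : ℝ) ≤ b := by exact_mod_cast hb
  have hb'R : (1 : ℝ) ≤ b' := by exact_mod_cast hb'
  have hab'R : (b' : ℝ) + 1 ≤ a' := by exact_mod_cast hab'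
  have hthinR : (b : ℝ) * a' ≤ (a : ℝ) * b' := by exact_mod_cast hthin
  have hlenR : (b : ℝ) * c' ≤ (c : ℝ) * b' := by exact_mod_cast hlen
  have hba : b < a := by
    by_contra hle
    have hleR : (a : ℝ) ≤ b := by exact_mod_cast (not_lt.1 hle)
    nlinarith
  have hbaR : (b : ℝ) + 1 ≤ a := by exact_mod_cast hba
  refine ⟨hba, ?_⟩
  have hd : (0 : ℝ) < (a : ℝ) - b := by linarith
  have hd' : (0 : ℝ) < (a' : ℝ) - b' := by linarith
  have hlog4 : 0 < Real.log 4 := Real.log_pos (by norm_num)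
  -- `κ = b/(a−b) ≤ κ' = b'/(a'−b')`
  have hκ : (b : ℝ) / ((a : ℝ) - b) ≤ (b' : ℝ) / ((a' : ℝ) - b') := by
    rw [div_le_div_iff₀ hd hd']; nlinarith
  -- `(a'+c')/b' ≤ (a+c)/b`
  have hb0 : (0 : ℝ) < b := by linarith
  have hb'0 : (0 : ℝ) < b' := by linarith
  have hg : ((a' : ℝ) + c') / b' ≤ ((a : ℝ) + c) / b := by
    rw [div_le_div_iff₀ hb'0 hb0]; nlinarith
  have hg0 : 0 < ((a' : ℝ) + c') / b' := div_pos (by linarith) hb'0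
  have hlogg := Real.log_le_log hg0 hg
  nlinarith [mul_le_mul_of_nonneg_left hκ hlog4.le]

end LengthFloor

end Summit.MatrixMultiplication.MatrixMultiplication.Theorems.SaturationLadderTransferLawRigidity

end
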